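import Summits.NavierStokesRegularity.NavierStokesRegularity.Theses.TautLoopKelvin
import Summits.NavierStokesRegularity.NavierStokesRegularity.Theorems.BlowupAssembly
import Summits.NavierStokesRegularity.NavierStokesRegularity.Theorems.BlowupBlowupClayNonuniquenessRefutation

/-!
# `CirculationFloor` (stmt-NavierStokesRegularity-1538): the hypothesis class is inhabited iff Clay (A) fails

Negative (support) lemma for the crux `TautLoopKelvin.CirculationFloor` = `CirculationRelay.CirculationFloor`
(shared entry ticket stmt-NavierStokesRegularity-1538), from the crux disprover's work file
`Cruxes/CirculationFloor/Disproof.lean` (cdisprove seat, cycle 1, 2026-08-17). It makes the VACUITY STATUS of the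
crux exact, complementing `Negative/LoadBearing.lean` (`not_navierStokesRegularity_of_not_circulationFloor`):

* `circulationFloor_hypotheses_iff_not_navierStokesRegularity` — the four hypotheses of the crux
  (`IsClassicalNSSolutionOn (Ico 0 T) ν 0 u p`, `IsLerayHopfOn T ν 0 (u 0) u`, `HasRapidSpatialDecay (u 0)`,
  `¬ HasSmoothExtensionPast ν 0 u T`, with `0 < ν`, `0 < T`) are JOINTLY SATISFIABLE if and only if
  `¬ NavierStokesRegularity`. (`→`: such an object is the conjunct `X5a` of the blow-up assembly and `X5b` is proved,
  `Literature.NS.blowup_assembly` + `BlowupBlowupClayNonuniqueness_refuted`; `←`: the PROVED frame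
  `typeICertificateLadder_noBlowupToClay_proof` (stmt-0055) turns "every such solution extends" into Clay (A).)
  So the crux has no junk satisfier and no missing satisfier: it speaks about exactly the Clay counterexamples —
  vacuously true (with every `c₀`) under (A), and a genuine statement about EVERY finite-energy classical blow-up
  from a Schwartz-class datum under ¬(A). A refuter can close the item only together with the Millennium problem.
* `circulationFloor_iff_of_not_navierStokesRegularity` — bookkeeping corollary: under (A) the crux holds outright,
  so `CirculationFloor ↔ (¬ NavierStokesRegularity → CirculationFloor)`; all content of the item lives on the
  blow-up branch.

[cite: Fefferman2000, (A) and §2 (the blow-up alternative); Tao2013 localisation, Cor. 11.4 for X5b]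
-/

noncomputable section

set_option linter.dupNamespace false

namespace Summit.NavierStokesRegularity.NavierStokesRegularity.Theorems.CirculationFloor.Negative

open Set
open Literature.Analysis.FluidPDE
open Summit.NavierStokesRegularity.NavierStokesRegularity.Theses

/-- **The hypothesis class of `CirculationFloor` is inhabited iff Clay (A) fails.** There are `ν, T > 0` and a
classical solution `(u, p)` of unforced Navier–Stokes on `ℝ³ × [0,T)`, Leray–Hopf on `[0,T]` from the rapidly
decaying datum `u 0`, with no smooth extension past `T`, if and only if `¬ NavierStokesRegularity`. [folklore] -/
theorem circulationFloor_hypotheses_iff_not_navierStokesRegularity :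
    (∃ (ν T : ℝ) (u : ℝ → EuclideanSpace ℝ (Fin 3) → EuclideanSpace ℝ (Fin 3))
        (p : ℝ → EuclideanSpace ℝ (Fin 3) → ℝ), 0 < ν ∧ 0 < T ∧
        IsClassicalNSSolutionOn (Set.Ico 0 T) ν 0 u p ∧ IsLerayHopfOn T ν 0 (u 0) u ∧
        HasRapidSpatialDecay (u 0) ∧ ¬ HasSmoothExtensionPast ν 0 u T) ↔ ¬ _root_.NavierStokesRegularity := by
  constructor
  · rintro ⟨ν, T, u, p, hν, hT, hcl, hLH, hdec, hext⟩ hA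
    exact Literature.NS.blowup_assembly ⟨⟨ν, hν, T, hT, u, p, ⟨hcl, hext⟩, hLH, hdec⟩,
      not_not.1 Summit.NavierStokesRegularity.NavierStokesRegularity.Theorems.BlowupBlowupClayNonuniqueness_refuted⟩ hA
  · intro hnA
    by_contra hne
    push Not at hne
    exact hnA (Summit.NavierStokesRegularity.NavierStokesRegularity.Theorems.typeICertificateLadder_noBlowupToClay_proof
      fun ν T hν hT u p hcl hLH hdec => hne ν T u p hν hT hcl hLH hdec)

/-- **All content of the crux lives on the blow-up branch**: since `NavierStokesRegularity → CirculationFloor`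
(vacuously, with any constant), the crux is equivalent to its restriction to `¬ NavierStokesRegularity`. [folklore] -/
theorem circulationFloor_iff_of_not_navierStokesRegularity :
    TautLoopKelvin.CirculationFloor ↔ (¬ _root_.NavierStokesRegularity → TautLoopKelvin.CirculationFloor) := by
  refine ⟨fun h _ => h, fun h => ?_⟩
  by_cases hA : _root_.NavierStokesRegularity
  · refine ⟨1, one_pos, fun ν T hν hT u p hcl hLH hdec hext _ _ => ?_⟩
    exact absurd hA (circulationFloor_hypotheses_iff_not_navierStokesRegularity.1
      ⟨ν, T, u, p, hν, hT, hcl, hLH, hdec, hext⟩)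
  · exact h hA

end Summit.NavierStokesRegularity.NavierStokesRegularity.Theorems.CirculationFloor.Negative

end
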